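import Literature.NumberTheory.EllipticCurves.RootNumberTwistProofs
import Summits.BirchSwinnertonDyer.BirchSwinnertonDyer.Theorems.ManinLocalTwoThreeManinPrimeToAdditiveFiveLeHorocyclicBottomIff
import Summits.BirchSwinnertonDyer.BirchSwinnertonDyer.Theorems.ManinLocalTwoThreeManinPrimeToAdditiveFiveLeOrdinaryCornerNotBottomOfOrdinaryTwistLaws
import HarnessLib

/-!
# Route `ManinLocalTwoThree`, residual crux C5 `ManinPrimeToAdditiveFiveLe` (stmt-BirchSwinnertonDyer-22969), single-book
# cone (`…_of_sevenPrints_of_twistFamilyItems`: … → C1 → C2 → C5): **C1 `EisensteinOrdinaryTwistLatticeNotBottom`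
# (stmt-25939, `p ≥ 11`) is EQUIVALENT, by name, to the existence of horocyclic witnesses** — the `p ≥ 11` twin of
# `ordinaryCornerDeepUnstarredNotBottom_iff_horocyclicWitnesses` (K18b″, `p ∈ {5, 7}`)

Width seat bsd-line-ml23-c5-p1-w3 (gen 3). The curve-free dictionary `horocyclic_bottom_iff_forall_horocyclicDifference_mem`
(«Edixhoven's case 1 BOTTOM(f, χ) ⟺ every horocyclic `k`-th difference `Σ_{i≤k} (−1)^i C(k,i) {∞, A/C + i/p}_f`,
`L ∣ C`, lies in `p·Λ_f`», `k = (p−1)/2`, every odd `p`) is uniform in `p`, so the reducible potentially-ordinary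
wall of route `TwistFamilyManinDescent` at `p ≥ 11` — C1 (stmt-25939: `p² ∣ N`, `11 ≤ p`, `Addv`, `¬Irr`, `TypeGOrd`,
`v_pΔ ≤ 4`, lattice-optimal datum ⟹ ¬BOTTOM for every quadratic primitive `χ`) — gets the same reformulation:
`eisensteinOrdinaryTwistLatticeNotBottom_iff_horocyclicWitnesses` — **C1 ⟺ on those rows some cusp `A/C` with
`N ∣ C > 0`, `gcd(A, C) = 1` has `Σ_{i≤k} (−1)^i C(k,i) {∞, A/C + i/p}_{f_W} ∉ p·Λ_{f_W}`** (one integral class of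
`H₁(X₀(N), ℤ)`-periods per curve instead of two lattices; no congruence condition on `A`).

HONEST STATUS. An unconditional EQUIVALENCE between OPEN statements; C1 is not proved; C2, C5, Manin's conjecture and
BSD are not proved. No summit statement is proved by this seat.

References: [EdixhovenManin1991] §4 (case 1); [Shimura1971] Prop. 3.64; [MazurTateTeitelbaum1986Invent] §I.8; crux dir
`Cruxes/ManinPrimeToAdditiveFiveLe/Lines/horocyclic-orientation.md`.
-/

set_option autoImplicit false
-- the Theorems namespace of this sub repeats the summit name by design (D-0017 nested layout)
set_option linter.dupNamespace false

noncomputable section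

open scoped Classical NumberField

namespace Summit.BirchSwinnertonDyer.BirchSwinnertonDyer.Theorems

section EquivalenceCOne

open WeierstrassCurve IsDedekindDomain NumberField Literature.NumberTheory.EllipticCurves
  Literature.NumberTheory.EllipticCurves.ModularForms Literature.NumberTheory.EllipticCurves.Rank1Residual
  Summit.BirchSwinnertonDyer.Rank1Residual.Additive

/-- **C1 (stmt-25939) ⟺ horocyclic witnesses (`p ≥ 11`).** On the rows of C1 (`p² ∣ N`, `11 ≤ p`, `Addv W p`,
`¬Irr W p`, `TypeGOrd W p`, `v_p Δ_min ≤ 4`, lattice-optimal datum `D`): «¬BOTTOM(f_W, χ) for every quadratic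
primitive `χ` mod `p`» holds for all such `(W, p, D)` iff for all such `(W, p, D)` there are `A, C ∈ ℤ` with
`N ∣ C > 0`, `gcd(A, C) = 1` and `Σ_{i≤k} (−1)^i C(k,i) {∞, A/C + i/p}_{f_W} ∉ p·Λ_{f_W}`, `k = (p−1)/2`. Both directions
through `horocyclic_bottom_iff_forall_horocyclicDifference_mem` at the Legendre character.
[cite: EdixhovenManin1991, §4] [cite: Shimura1971, Prop. 3.64] [cite: MazurTateTeitelbaum1986Invent, §I.8] -/
theorem eisensteinOrdinaryTwistLatticeNotBottom_iff_horocyclicWitnesses :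
    Summit.BirchSwinnertonDyer.BirchSwinnertonDyer.Theses.TwistFamilyManinDescent.EisensteinOrdinaryTwistLatticeNotBottom ↔
    ∀ (W : WeierstrassCurve ℚ) [W.IsElliptic] [W.IsGloballyMinimal] (p : ℕ) [Fact p.Prime]
      [NeZero (W.conductorNorm ℤ)] (D : ModularParametrizationData W (W.conductorNorm ℤ))
      (_hsq : p ^ 2 ∣ W.conductorNorm ℤ), 11 ≤ p → Addv W p → ¬ Irr W p → TypeGOrd W p →
      padicValInt p W.minimalDiscriminantInt ≤ 4 →
      (∀ z ∈ D.L.lattice, ∃ w ∈ periodLattice D.f, z = D.c * w) →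
      ∃ (A C : ℤ), (W.conductorNorm ℤ : ℤ) ∣ C ∧ 0 < C ∧ IsCoprime A C ∧
        ¬ ∃ y ∈ periodLattice D.f, (∑ i ∈ Finset.range ((p - 1) / 2 + 1),
          ((((-1 : ℤ) ^ i * (((p - 1) / 2).choose i : ℕ)) : ℤ) : ℂ) *
            modularSymbol D.f ((A : ℚ) / (C : ℚ) + (i : ℚ) / (p : ℚ))) = (p : ℂ) * y := by
  constructor
  · -- (⟹): C1 at the Legendre character, then the dictionary
    intro hK W _ _ p _ _ D hsq hp11 hadd hred hord hv hopt
    have hp2 : p ≠ 2 := by omega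
    set χ₀ : DirichletCharacter ℂ p := (quadraticChar (ZMod p)).ringHomComp (Int.castRingHom ℂ) with hχ₀
    have hq : χ₀.IsQuadratic := isQuadratic_quadraticChar_ringHomComp p
    have hprim : χ₀.IsPrimitive := isPrimitive_quadraticChar_ringHomComp p hp2
    have hχL : ∀ u : ZMod p, χ₀ u = ((quadraticChar (ZMod p) u : ℤ) : ℂ) := fun u ↦ by
      rw [hχ₀, MulChar.ringHomComp_apply, eq_intCast]
    have hnot := hK W p D hsq hp11 hadd hred hord hv hopt χ₀ hq hprim
    rw [horocyclic_bottom_iff_forall_horocyclicDifference_mem D.f hp2 (dvd_refl _) hsq hq hχL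
      (gaussSum_stdAddChar_ne_zero_of_isPrimitive hprim)] at hnot
    push Not at hnot
    obtain ⟨A, C, hNC, hC, hAC, hne⟩ := hnot
    -- normalise the sign of `C`
    rcases lt_or_gt_of_ne hC with hlt | hgt
    · refine ⟨-A, -C, (dvd_neg).mpr hNC, by omega, hAC.neg_neg, ?_⟩
      rintro ⟨y, hy, e⟩
      refine hne y hy ?_
      rw [← e]
      refine Finset.sum_congr rfl fun i _ ↦ ?_
      push_cast
      rw [neg_div_neg_eq]
    · refine ⟨A, C, hNC, hgt, hAC, ?_⟩
      rintro ⟨y, hy, e⟩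
      exact hne y hy e
  · -- (⟸): a witness forbids BOTTOM for the quadratic primitive character
    intro H W _ _ p _ _ D hsq hp11 hadd hred hord hv hopt χ hχ hprim hbot
    obtain ⟨A, C, hNC, hC0, hAC, hnot⟩ := H W p D hsq hp11 hadd hred hord hv hopt
    have hp2 : p ≠ 2 := by omega
    have hχL : ∀ u : ZMod p, χ u = ((quadraticChar (ZMod p) u : ℤ) : ℂ) := fun u ↦ by
      rw [dirichletCharacter_eq_quadraticChar_of_isQuadratic_of_isPrimitive hp2 χ hχ hprim,
        MulChar.ringHomComp_apply, eq_intCast]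
    exact hnot ((horocyclic_bottom_iff_forall_horocyclicDifference_mem D.f hp2 (dvd_refl _) hsq hχ hχL
      (gaussSum_stdAddChar_ne_zero_of_isPrimitive hprim)).mp hbot A C hNC hC0.ne' hAC)

end EquivalenceCOne

end Summit.BirchSwinnertonDyer.BirchSwinnertonDyer.Theorems

end
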